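import Summits.ValiantsHypothesis.ValiantsHypothesis.Theorems.KPlusLogSqLawTropicalBToeplitzDoubling
import Summits.ValiantsHypothesis.ValiantsHypothesis.Theorems.KPlusLogSqLawTropicalBToeplitzDoublingMorphPrelims
import Summits.ValiantsHypothesis.ValiantsHypothesis.Theorems.KPlusLogSqLawTropicalBToeplitzMorphMember

/-!
# Route `KPlusLogSqLaw`, crux `TropicalB` — Toeplitz sector: THE MORPH-DOUBLING LAW `Φ_Q(2n) ≥ Φ_Q(n) + Φ_Q(n)′ − 1 + ⌊n/4⌋`

HONEST FRAMING.  Helper toward the registered stubs `stub_tropThin` / `stub_tropFat` (crux `…Theses.KPlusLogSqLaw.TropicalB`, item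
`stmt-ValiantsHypothesis-19771`; cell `pub-symmetroid`, seat `val-sym-trop-p4` (g23), 2026-08-29).  The doubling law of `…ToeplitzDoubling`
WITH ITS BOTTOM PHASE: in the doubled quadratic-slope instance of size `2n = 4q` (positive displacements = instance 1, negative = instance 2 shifted
by `μ`, footrule reward `C|δ|`), below the two bipartite phases the weight is `t·Σ|δ|(K − 2|δ|) + (bounded remainder)` at slope `−2t`,
`C = K t`; by THE MORPH THEOREM (`…ToeplitzMorphMember`, odd members `μ_{2h+1}`, `0 ≤ h < ⌊q/2⌋`) and the pencil transfer
(`…ToeplitzDoublingMorphPrelims`) each morph member is the UNIQUE optimum at its own slope (`K_h = 4q+4h+3`, `C = 2C₁·(3n)!`,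
`t_h = 2C₁·(3n)!/K_h`), the members are pairwise distinct (`τ(q−1) = 2q+2h`) and non-bipartite (`τ q = 0`), so the chain gains `⌊q/2⌋ = ⌊n/4⌋`
members: `¬Free(n,N₁) → ¬Free(n,N₂) → ¬Free(2n, N₁+N₂+⌊n/4⌋)` for `n = 2q ≥ 4` (`not_fixedSlopeFree_sq_double_morph`,
`fixedSlope_sq_doubling_morph`).  CONSEQUENCE (`…ToeplitzSuperlinear`): `Φ_Q(32·2^k) ≥ 2^k(160+4k)+1`, `¬ConjectureQ`, `¬ConjectureTLinear`.
Nothing here bounds `Φ_Toep` from above; `ConjectureTPoly` / `TropicalB` stay OPEN; nothing on `MatrixDescartes` or `VP ≠ VNP`.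
-/

set_option linter.dupNamespace false
set_option autoImplicit false

namespace Summit.ValiantsHypothesis.ValiantsHypothesis.Theorems.KPlusLogSqLaw.Toeplitz

open scoped BigOperators
open Finset

set_option maxHeartbeats 8000000 in
/-- **THE MORPH-DOUBLING LAW, free form**: `¬Free(2q, N₁) → ¬Free(2q, N₂) → ¬Free(2q+2q, N₁+N₂+⌊q/2⌋)` for the quadratic-slope class
(`q ≥ 2`).  Members: the `⌊q/2⌋` odd morph members at the bottom slopes, then `(τ¹_k, id)`, then `(rev, τ²_j)`. -/
theorem not_fixedSlopeFree_sq_double_morph {q N₁ N₂ : ℕ} (hq : 2 ≤ q)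
    (h₁ : ¬ FixedSlopeFreeInstanceBound (2 * q) (fun δ : ℤ => δ ^ 2) N₁)
    (h₂ : ¬ FixedSlopeFreeInstanceBound (2 * q) (fun δ : ℤ => δ ^ 2) N₂) :
    ¬ FixedSlopeFreeInstanceBound (2 * q + 2 * q) (fun δ : ℤ => δ ^ 2) (N₁ + N₂ + q / 2) := by
  set n : ℕ := 2 * q with hn
  set M : ℕ := q / 2 with hM
  have HM : ∀ k : Fin M, ∃ τ : Equiv.Perm (Fin (n + n)),
      ((τ ⟨q - 1, by omega⟩ : Fin (n + n)) : ℕ) = n + 2 * (k : ℕ) ∧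
      ((τ ⟨q, by omega⟩ : Fin (n + n)) : ℕ) = 0 ∧
      ∀ σ : Equiv.Perm (Fin (n + n)), σ ≠ τ →
        ∑ b : Fin (n + n), |((σ b : Fin (n + n)) : ℤ) - (b : ℤ)| *
            ((4 * q + 4 * (k : ℕ) + 3 : ℤ) - 2 * |((σ b : Fin (n + n)) : ℤ) - (b : ℤ)|) <
        ∑ b : Fin (n + n), |((τ b : Fin (n + n)) : ℤ) - (b : ℤ)| *
            ((4 * q + 4 * (k : ℕ) + 3 : ℤ) - 2 * |((τ b : Fin (n + n)) : ℤ) - (b : ℤ)|) :=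
    fun k => morph_member q k (by have := k.isLt; omega)
  choose μm hμA hμB hμopt using HM
  unfold FixedSlopeFreeInstanceBound at h₁ h₂
  push Not at h₁ h₂
  obtain ⟨α₁, K₁, θ₁, τ₁, hθ₁, hτ₁, hopt₁, hK₁⟩ := h₁
  obtain ⟨α₂, K₂, θ₂, τ₂, hθ₂, hτ₂, hopt₂, hK₂⟩ := h₂
  intro hB
  -- constants (as in `not_fixedSlopeFree_sq_double`, with a larger and divisible `C`)
  set A : ℤ := ∑ d ∈ Icc (-(n : ℤ)) n, (|α₁ d| + |α₂ d|) with hAdef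
  have hA0 : 0 ≤ A := sum_nonneg fun _ _ => by positivity
  have hnA : (0:ℤ) ≤ (n : ℤ) * A := by positivity
  have hA1 : ∀ d : ℤ, -(n : ℤ) ≤ d → d ≤ n → |α₁ d| ≤ A := fun d hd1 hd2 => by
    have := single_le_sum (f := fun d => |α₁ d| + |α₂ d|) (fun _ _ => by positivity) (mem_Icc.mpr ⟨hd1, hd2⟩)
    have := abs_nonneg (α₂ d); omega
  have hA2 : ∀ d : ℤ, -(n : ℤ) ≤ d → d ≤ n → |α₂ d| ≤ A := fun d hd1 hd2 => by
    have := single_le_sum (f := fun d => |α₁ d| + |α₂ d|) (fun _ _ => by positivity) (mem_Icc.mpr ⟨hd1, hd2⟩)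
    have := abs_nonneg (α₁ d); omega
  set Θ₁ : ℤ := ∑ k, |θ₁ k| with hΘ₁def
  set Θ₂ : ℤ := ∑ j, |θ₂ j| with hΘ₂def
  have hΘ₁ : ∀ k, |θ₁ k| ≤ Θ₁ := fun k => single_le_sum (f := fun k => |θ₁ k|) (fun _ _ => abs_nonneg _) (mem_univ k)
  have hΘ₂ : ∀ j, |θ₂ j| ≤ Θ₂ := fun j => single_le_sum (f := fun j => |θ₂ j|) (fun _ _ => abs_nonneg _) (mem_univ j)
  have hΘ₁0 : 0 ≤ Θ₁ := sum_nonneg fun _ _ => abs_nonneg _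
  have hΘ₂0 : 0 ≤ Θ₂ := sum_nonneg fun _ _ => abs_nonneg _
  set μ : ℤ := Θ₁ + Θ₂ + 2 * n * A + 1 with hμdef
  have hμ0 : 0 ≤ μ := by positivity
  set G : ℤ := A + μ * (n : ℤ) ^ 2 with hGdef
  have hG0 : 0 ≤ G := by positivity
  have hnG : (0:ℤ) ≤ (n : ℤ) * G := by positivity
  set Θ : ℤ := Θ₁ + μ + Θ₂ with hΘdef
  have hΘ0 : 0 ≤ Θ := by positivity
  set S : ℤ := Θ * (((n : ℤ) + n) * ((n : ℤ) + n) ^ 2) + ((n : ℤ) + n) * G with hSdef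
  have hS0 : 0 ≤ S := by positivity
  have hSΘ : Θ₁ ≤ S := by
    have h1 : (1 : ℤ) ≤ ((n : ℤ) + n) * ((n : ℤ) + n) ^ 2 := by
      have : (1 : ℤ) ≤ (n : ℤ) + n := by omega
      nlinarith
    nlinarith [mul_le_mul_of_nonneg_left h1 hΘ0]
  set C₁ : ℤ := 2 * S + 2 * (n : ℤ) * G + 1 with hC₁def
  have hC₁0 : 0 < C₁ := by positivity
  set F : ℕ := (3 * n).factorial with hFdef
  set C : ℤ := 2 * C₁ * (F : ℤ) with hCdef
  have hF1 : (1 : ℤ) ≤ (F : ℤ) := by exact_mod_cast Nat.succ_le_of_lt (Nat.factorial_pos _)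
  have hC : 2 * S + 1 ≤ C := by nlinarith [mul_le_mul_of_nonneg_left hF1 (by positivity : (0:ℤ) ≤ 2 * C₁)]
  have hC0 : 0 ≤ C := by linarith
  -- the doubled intercepts
  set g : ℤ → ℤ := fun δ => if 0 < δ then α₁ (δ - n) else if δ < 0 then α₂ (δ + n) - μ * (δ + n) ^ 2 else 0 with hgdef
  set α' : ℤ → ℤ := fun δ => g δ + C * |δ| with hα'def
  let mk : Equiv.Perm (Fin n) → Equiv.Perm (Fin n) → Equiv.Perm (Fin (n + n)) := fun π ρ =>
    finSumFinEquiv.symm.trans ((Equiv.sumCongr π ρ).trans ((Equiv.sumComm (Fin n) (Fin n)).trans finSumFinEquiv))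
  have hmkl : ∀ π ρ (a : Fin n), mk π ρ (Fin.castAdd n a) = Fin.natAdd n (π a) := fun π ρ a => mkBip_apply_castAdd π ρ a
  have hmkr : ∀ π ρ (i : Fin n), mk π ρ (Fin.natAdd n i) = Fin.castAdd n (ρ i) := fun π ρ i => mkBip_apply_natAdd π ρ i
  let X : Equiv.Perm (Fin n) → ℤ := fun π => ∑ a : Fin n, (((π a : Fin n) : ℤ) - (a : ℤ)) ^ 2
  let Y₁ : Equiv.Perm (Fin n) → ℤ := fun π => ∑ a : Fin n, α₁ (((π a : Fin n) : ℤ) - (a : ℤ))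
  let Y₂ : Equiv.Perm (Fin n) → ℤ := fun π => ∑ a : Fin n, α₂ (((π a : Fin n) : ℤ) - (a : ℤ))
  let W : ℤ → Equiv.Perm (Fin (n + n)) → ℤ := fun θ σ =>
    ∑ p : Fin (n + n), (θ * (fun δ : ℤ => δ ^ 2) (((σ p : Fin (n + n)) : ℤ) - (p : ℤ)) + α' (((σ p : Fin (n + n)) : ℤ) - (p : ℤ)))
  have hWmk : ∀ θ π ρ, W θ (mk π ρ) = θ * (2 * (n : ℤ) ^ 3 + X π + X ρ) + Y₁ π + Y₂ ρ - μ * X ρ + C * (2 * (n : ℤ) ^ 2) :=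
    fun θ π ρ => weight_halves α₁ α₂ μ C θ π ρ (mk π ρ) (hmkl π ρ) (hmkr π ρ)
  have hW1 : ∀ θ (π : Equiv.Perm (Fin n)), ∑ b, (θ * (fun δ : ℤ => δ ^ 2) ((π b : ℤ) - (b : ℤ)) + α₁ ((π b : ℤ) - (b : ℤ))) =
      θ * X π + Y₁ π := fun θ π => by simp only [X, Y₁, sum_add_distrib, ← mul_sum]
  have hW2 : ∀ θ (π : Equiv.Perm (Fin n)), ∑ b, (θ * (fun δ : ℤ => δ ^ 2) ((π b : ℤ) - (b : ℤ)) + α₂ ((π b : ℤ) - (b : ℤ))) =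
      θ * X π + Y₂ π := fun θ π => by simp only [X, Y₂, sum_add_distrib, ← mul_sum]
  have hY1 : ∀ π, |Y₁ π| ≤ (n : ℤ) * A := fun π => abs_sum_alpha_le α₁ A hA1 π
  have hY2 : ∀ π, |Y₂ π| ≤ (n : ℤ) * A := fun π => abs_sum_alpha_le α₂ A hA2 π
  have hX0 : ∀ π, 0 ≤ X π := fun π => sum_nonneg fun _ _ => sq_nonneg _
  have hgG : ∀ δ : ℤ, -((n : ℤ) + n) < δ → δ < (n : ℤ) + n → |g δ| ≤ G := fun δ hd1 hd2 => by
    have := abs_g_le (n := n) α₁ α₂ μ hμ0 δ hd1 hd2; simpa [hgdef, hGdef, hAdef] using this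
  have hgsum : ∀ σ : Equiv.Perm (Fin (n + n)), |∑ p : Fin (n + n), g (((σ p : Fin (n + n)) : ℤ) - (p : ℤ))| ≤ ((n : ℤ) + n) * G :=
    fun σ => by
      have h2 := abs_sum_le_of_bound σ g G (fun δ hd1 hd2 => hgG δ (by push_cast at hd1; linarith) (by push_cast at hd2; linarith))
      push_cast at h2; exact h2
  have hgen : ∀ θ (σ : Equiv.Perm (Fin (n + n))), |θ| ≤ Θ →
      |∑ p : Fin (n + n), θ * (((σ p : Fin (n + n)) : ℤ) - (p : ℤ)) ^ 2 + ∑ p : Fin (n + n), g (((σ p : Fin (n + n)) : ℤ) - (p : ℤ))| ≤ S := by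
    intro θ σ hθ
    have h1 := abs_sum_sq_displacement_le σ θ
    have h2 := hgsum σ
    have h3 := abs_add_le (∑ p : Fin (n + n), θ * (((σ p : Fin (n + n)) : ℤ) - (p : ℤ)) ^ 2)
      (∑ p : Fin (n + n), g (((σ p : Fin (n + n)) : ℤ) - (p : ℤ)))
    have hnn : (0 : ℤ) ≤ ((n : ℤ) + n) * ((n : ℤ) + n) ^ 2 := by positivity
    have h4 : |θ| * (((n : ℤ) + n) * ((n : ℤ) + n) ^ 2) ≤ Θ * (((n : ℤ) + n) * ((n : ℤ) + n) ^ 2) :=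
      mul_le_mul_of_nonneg_right hθ hnn
    push_cast at h1
    linarith
  have hWsplit : ∀ θ (σ : Equiv.Perm (Fin (n + n))), W θ σ =
      (∑ p : Fin (n + n), θ * (((σ p : Fin (n + n)) : ℤ) - (p : ℤ)) ^ 2 + ∑ p : Fin (n + n), g (((σ p : Fin (n + n)) : ℤ) - (p : ℤ)))
        + C * ∑ p : Fin (n + n), |((σ p : Fin (n + n)) : ℤ) - (p : ℤ)| := fun θ σ => weight_split α₁ α₂ μ C θ σ
  -- KEY COMPARISON 1: non-bipartite competitors lose at slopes |θ| ≤ Θ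
  have hnonbip : ∀ θ (π ρ : Equiv.Perm (Fin n)) (σ : Equiv.Perm (Fin (n + n))), |θ| ≤ Θ →
      ¬ (∀ p : Fin (n + n), (p : ℕ) < n ↔ n ≤ ((σ p : Fin (n + n)) : ℕ)) → W θ σ < W θ (mk π ρ) := by
    intro θ π ρ σ hθ hnb
    have hFσ : ∑ p : Fin (n + n), |((σ p : Fin (n + n)) : ℤ) - (p : ℤ)| ≤ 2 * (n : ℤ) ^ 2 - 1 := by
      have hle := footrule_le σ
      rcases lt_or_eq_of_le hle with hlt | heq
      · omega
      · exact absurd (lt_iff_le_of_footrule_eq σ heq) hnb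
    have hFm : ∑ p : Fin (n + n), |((mk π ρ p : Fin (n + n)) : ℤ) - (p : ℤ)| = 2 * (n : ℤ) ^ 2 :=
      footrule_eq_of_bipartite _ (bipartite_of_halves π ρ _ (hmkl π ρ) (hmkr π ρ))
    have hb1 := hgen θ σ hθ
    have hb2 := hgen θ (mk π ρ) hθ
    rw [hWsplit, hWsplit, hFm]
    rw [abs_le] at hb1 hb2
    have hm := mul_le_mul_of_nonneg_left hFσ hC0
    linarith
  have hXid : X 1 = 0 := by simp [X]
  have hXpos : ∀ ρ : Equiv.Perm (Fin n), ρ ≠ 1 → 1 ≤ X ρ := fun ρ hρ => one_le_sq_displacement_sum hρ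
  have hXrev : ∀ π : Equiv.Perm (Fin n), π ≠ Fin.revPerm → X π + 1 ≤ X Fin.revPerm := fun π hπ => sq_displacement_sum_succ_le_rev hπ
  -- KEY COMPARISON 2 (phase 1)
  have hph1 : ∀ (k : Fin (K₁ + 1)) (π ρ : Equiv.Perm (Fin n)), (π, ρ) ≠ (τ₁ k, 1) →
      W (θ₁ k) (mk π ρ) < W (θ₁ k) (mk (τ₁ k) 1) := by
    intro k π ρ hne
    rw [hWmk, hWmk, hXid]
    have hθk : |θ₁ k| ≤ Θ₁ := hΘ₁ k
    have hb1 : θ₁ k * X π + Y₁ π ≤ θ₁ k * X (τ₁ k) + Y₁ (τ₁ k) ∧ (π ≠ τ₁ k → θ₁ k * X π + Y₁ π < θ₁ k * X (τ₁ k) + Y₁ (τ₁ k)) := by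
      constructor
      · by_cases hπ : π = τ₁ k
        · rw [hπ]
        · have := hopt₁ k π hπ; rw [hW1, hW1] at this; exact this.le
      · intro hπ; have := hopt₁ k π hπ; rw [hW1, hW1] at this; exact this
    have hb2 : (θ₁ k - μ) * X ρ + Y₂ ρ ≤ Y₂ 1 ∧ (ρ ≠ 1 → (θ₁ k - μ) * X ρ + Y₂ ρ < Y₂ 1) := by
      have hy := hY2 ρ; have hy1 := hY2 1
      rw [abs_le] at hy hy1 hθk
      have hneg : θ₁ k - μ ≤ 0 := by linarith
      have key : ρ ≠ 1 → (θ₁ k - μ) * X ρ + Y₂ ρ < Y₂ 1 := fun hρ => by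
        have hx := hXpos ρ hρ
        have hm := mul_le_mul_of_nonpos_left hx hneg
        linarith
      constructor
      · by_cases hρ : ρ = 1
        · rw [hρ, hXid]; simp
        · exact (key hρ).le
      · exact key
    rcases hb1 with ⟨hb1le, hb1lt⟩
    rcases hb2 with ⟨hb2le, hb2lt⟩
    by_cases hπ : π = τ₁ k
    · have hρ : ρ ≠ 1 := fun h => hne (by rw [hπ, h])
      have := hb2lt hρ; rw [hπ]; linarith [hX0 ρ]
    · have := hb1lt hπ; linarith [hX0 ρ]
  -- KEY COMPARISON 3 (phase 2)
  have hph2 : ∀ (j : Fin (K₂ + 1)) (π ρ : Equiv.Perm (Fin n)), (π, ρ) ≠ (Fin.revPerm, τ₂ j) →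
      W (μ + θ₂ j) (mk π ρ) < W (μ + θ₂ j) (mk Fin.revPerm (τ₂ j)) := by
    intro j π ρ hne
    rw [hWmk, hWmk]
    have hθj : |θ₂ j| ≤ Θ₂ := hΘ₂ j
    have hb1 : (μ + θ₂ j) * X π + Y₁ π ≤ (μ + θ₂ j) * X Fin.revPerm + Y₁ Fin.revPerm ∧
        (π ≠ Fin.revPerm → (μ + θ₂ j) * X π + Y₁ π < (μ + θ₂ j) * X Fin.revPerm + Y₁ Fin.revPerm) := by
      have hy := hY1 π; have hy1 := hY1 Fin.revPerm
      rw [abs_le] at hy hy1 hθj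
      have hpos : 0 ≤ μ + θ₂ j := by linarith
      have key : π ≠ Fin.revPerm → (μ + θ₂ j) * X π + Y₁ π < (μ + θ₂ j) * X Fin.revPerm + Y₁ Fin.revPerm := fun hπ => by
        have hx := hXrev π hπ
        have hm := mul_le_mul_of_nonneg_left hx hpos
        linarith
      constructor
      · by_cases hπ : π = Fin.revPerm
        · rw [hπ]
        · exact (key hπ).le
      · exact key
    have hb2 : (μ + θ₂ j - μ) * X ρ + Y₂ ρ ≤ (μ + θ₂ j - μ) * X (τ₂ j) + Y₂ (τ₂ j) ∧
        (ρ ≠ τ₂ j → (μ + θ₂ j - μ) * X ρ + Y₂ ρ < (μ + θ₂ j - μ) * X (τ₂ j) + Y₂ (τ₂ j)) := by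
      rw [show μ + θ₂ j - μ = θ₂ j by ring]
      constructor
      · by_cases hρ : ρ = τ₂ j
        · rw [hρ]
        · have := hopt₂ j ρ hρ; rw [hW2, hW2] at this; exact this.le
      · intro hρ; have := hopt₂ j ρ hρ; rw [hW2, hW2] at this; exact this
    rcases hb1 with ⟨hb1le, hb1lt⟩
    rcases hb2 with ⟨hb2le, hb2lt⟩
    by_cases hπ : π = Fin.revPerm
    · have hρ : ρ ≠ τ₂ j := fun h => hne (by rw [hπ, h])
      have := hb2lt hρ; rw [hπ]; linarith
    · have := hb1lt hπ; linarith
  -- the bipartite part of the chain (phases 1 and 2), as in `not_fixedSlopeFree_sq_double`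
  let θp : Fin (K₁ + K₂ + 1) → ℤ := fun k =>
    if h : (k : ℕ) ≤ K₁ then θ₁ ⟨k, by omega⟩ else μ + θ₂ ⟨k - K₁, by omega⟩
  let τp : Fin (K₁ + K₂ + 1) → Equiv.Perm (Fin (n + n)) := fun k =>
    if h : (k : ℕ) ≤ K₁ then mk (τ₁ ⟨k, by omega⟩) 1 else mk Fin.revPerm (τ₂ ⟨k - K₁, by omega⟩)
  have hθpbd : ∀ k, |θp k| ≤ Θ := by
    intro k
    by_cases h : (k : ℕ) ≤ K₁
    · simp only [θp, dif_pos h]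
      have := hΘ₁ ⟨k, by omega⟩; rw [abs_le] at this ⊢; constructor <;> linarith
    · simp only [θp, dif_neg h]
      have := hΘ₂ ⟨k - K₁, by omega⟩; rw [abs_le] at this ⊢; constructor <;> linarith
  have hθplow : ∀ k, -Θ₁ ≤ θp k := by
    intro k
    by_cases h : (k : ℕ) ≤ K₁
    · simp only [θp, dif_pos h]
      have := hΘ₁ ⟨k, by omega⟩; rw [abs_le] at this; linarith
    · simp only [θp, dif_neg h]
      have := hΘ₂ ⟨k - K₁, by omega⟩; rw [abs_le] at this; linarith
  have hθpmono : StrictMono θp := by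
    intro i j hij
    have hij' : (i : ℕ) < j := hij
    by_cases hi : (i : ℕ) ≤ K₁ <;> by_cases hj : (j : ℕ) ≤ K₁
    · simp only [θp, dif_pos hi, dif_pos hj]
      exact hθ₁ (show (⟨i, by omega⟩ : Fin (K₁ + 1)) < ⟨j, by omega⟩ from Fin.mk_lt_mk.mpr hij')
    · simp only [θp, dif_pos hi, dif_neg hj]
      have h1 := hΘ₁ ⟨i, by omega⟩; have h2 := hΘ₂ ⟨j - K₁, by omega⟩
      rw [abs_le] at h1 h2
      nlinarith
    · omega
    · simp only [θp, dif_neg hi, dif_neg hj]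
      have : (⟨(i : ℕ) - K₁, by omega⟩ : Fin (K₂ + 1)) < ⟨j - K₁, by omega⟩ := Fin.mk_lt_mk.mpr (by omega)
      have := hθ₂ this; linarith
  have hoptp : ∀ k (σ : Equiv.Perm (Fin (n + n))), σ ≠ τp k → W (θp k) σ < W (θp k) (τp k) := by
    intro k σ hσ
    by_cases hb : ∀ p : Fin (n + n), (p : ℕ) < n ↔ n ≤ ((σ p : Fin (n + n)) : ℕ)
    · obtain ⟨π, ρ, hl, hr⟩ := exists_halves_of_bipartite σ hb
      have hσeq : σ = mk π ρ := eq_mkBip_of_apply π ρ σ hl hr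
      rw [hσeq] at hσ ⊢
      by_cases h : (k : ℕ) ≤ K₁
      · simp only [θp, τp, dif_pos h] at hσ ⊢
        refine hph1 ⟨k, by omega⟩ π ρ fun hpr => hσ ?_
        rw [Prod.mk.injEq] at hpr; rw [hpr.1, hpr.2]
      · simp only [θp, τp, dif_neg h] at hσ ⊢
        refine hph2 ⟨k - K₁, by omega⟩ π ρ fun hpr => hσ ?_
        rw [Prod.mk.injEq] at hpr; rw [hpr.1, hpr.2]
    · by_cases h : (k : ℕ) ≤ K₁
      · simp only [θp, τp, dif_pos h]
        exact hnonbip _ _ _ σ (by have := hθpbd k; simpa [θp, dif_pos h] using this) hb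
      · simp only [θp, τp, dif_neg h]
        exact hnonbip _ _ _ σ (by have := hθpbd k; simpa [θp, dif_neg h] using this) hb
  have hXmk : ∀ π ρ, ∑ p : Fin (n + n), (((mk π ρ p : Fin (n + n)) : ℤ) - (p : ℤ)) ^ 2 = 2 * (n : ℤ) ^ 3 + X π + X ρ :=
    fun π ρ => sq_sum_bip π ρ (mk π ρ) (hmkl π ρ) (hmkr π ρ)
  have hX1mono := sq_displacement_sum_strictMono_of_chain α₁ θ₁ τ₁ hθ₁ hτ₁ hopt₁
  have hX2mono := sq_displacement_sum_strictMono_of_chain α₂ θ₂ τ₂ hθ₂ hτ₂ hopt₂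
  have hinjp : Function.Injective τp := by
    have hsm : StrictMono fun k => ∑ p : Fin (n + n), (((τp k p : Fin (n + n)) : ℤ) - (p : ℤ)) ^ 2 := by
      intro i j hij
      have hij' : (i : ℕ) < j := hij
      by_cases hi : (i : ℕ) ≤ K₁ <;> by_cases hj : (j : ℕ) ≤ K₁
      · simp only [τp, dif_pos hi, dif_pos hj, hXmk, hXid]
        have := hX1mono (show (⟨i, by omega⟩ : Fin (K₁ + 1)) < ⟨j, by omega⟩ from Fin.mk_lt_mk.mpr hij')
        simp only at this; linarith
      · simp only [τp, dif_pos hi, dif_neg hj, hXmk, hXid]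
        have hle : X (τ₁ ⟨i, by omega⟩) ≤ X Fin.revPerm := by
          by_cases hr : τ₁ ⟨i, by omega⟩ = Fin.revPerm
          · rw [hr]
          · have := hXrev _ hr; linarith
        have hne : τ₂ ⟨j - K₁, by omega⟩ ≠ 1 := by
          intro h1
          have := eq_zero_of_chain_eq_one α₂ θ₂ τ₂ hθ₂ hτ₂ hopt₂ h1
          rw [Fin.ext_iff] at this; simp only [Fin.val_zero] at this; omega
        have := hXpos _ hne
        linarith
      · omega
      · simp only [τp, dif_neg hi, dif_neg hj, hXmk]
        have : (⟨(i : ℕ) - K₁, by omega⟩ : Fin (K₂ + 1)) < ⟨j - K₁, by omega⟩ := Fin.mk_lt_mk.mpr (by omega)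
        have := hX2mono this; simp only at this; linarith
    intro i j h
    apply hsm.injective
    show (∑ p : Fin (n + n), (((τp i p : Fin (n + n)) : ℤ) - (p : ℤ)) ^ 2) = ∑ p : Fin (n + n), (((τp j p : Fin (n + n)) : ℤ) - (p : ℤ)) ^ 2
    rw [h]
  -- a bipartite member never fixes the block structure at position `q`; a morph member sends `q ↦ 0`
  have hτp_q : ∀ k, n ≤ ((τp k ⟨q, by omega⟩ : Fin (n + n)) : ℕ) := by
    intro k
    have hcast : (⟨q, by omega⟩ : Fin (n + n)) = Fin.castAdd n ⟨q, by omega⟩ := Fin.ext rfl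
    by_cases h : (k : ℕ) ≤ K₁
    · simp only [τp, dif_pos h]; rw [hcast, hmkl]; simp
    · simp only [τp, dif_neg h]; rw [hcast, hmkl]; simp
  -- the bottom phase: slopes and members
  have hKle : ∀ k : Fin M, 4 * q + 4 * (k : ℕ) + 3 ≤ 3 * n := fun k => by have := k.isLt; omega
  let tn : Fin M → ℕ := fun k => F / (4 * q + 4 * (k : ℕ) + 3)
  have htn1 : ∀ k : Fin M, 1 ≤ (tn k : ℤ) := fun k => by
    have := factorial_div_pos (3 * n) (4 * q + 4 * (k : ℕ) + 3) (by omega) (hKle k)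
    exact_mod_cast this
  have htnK : ∀ k : Fin M, ((4 * q + 4 * (k : ℕ) + 3 : ℕ) : ℤ) * (tn k : ℤ) = (F : ℤ) := fun k => by
    have := Nat.mul_div_cancel' (Nat.dvd_factorial (by omega : 0 < 4 * q + 4 * (k : ℕ) + 3) (hKle k))
    exact_mod_cast this
  have htnanti : ∀ i j : Fin M, (i : ℕ) < j → (tn j : ℤ) < tn i := fun i j hij => by
    have := factorial_div_anti (3 * n) (4 * q + 4 * (i : ℕ) + 3) (4 * q + 4 * (j : ℕ) + 3) (by omega) (by omega) (hKle j)
    exact_mod_cast this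
  let θb : Fin M → ℤ := fun k => -2 * (2 * C₁ * (tn k : ℤ))
  have hθbmono : ∀ i j : Fin M, (i : ℕ) < j → θb i < θb j := fun i j hij => by
    have := htnanti i j hij; simp only [θb]; nlinarith [mul_lt_mul_of_pos_left this hC₁0]
  have hθbtop : ∀ k : Fin M, θb k < -Θ₁ := fun k => by
    have := htn1 k; simp only [θb]; nlinarith [mul_le_mul_of_nonneg_left this hC₁0.le]
  have hoptb : ∀ (k : Fin M) (σ : Equiv.Perm (Fin (n + n))), σ ≠ μm k → W (θb k) σ < W (θb k) (μm k) := by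
    intro k σ hσ
    have hCk : C = ((4 * q + 4 * (k : ℕ) + 3 : ℕ) : ℤ) * (2 * C₁ * (tn k : ℤ)) := by
      have := htnK k; simp only [hCdef]; linear_combination (2 * C₁) * this.symm
    have ht : 2 * (((n : ℤ) + n) * G) < 2 * C₁ * (tn k : ℤ) := by
      have := htn1 k; nlinarith [mul_le_mul_of_nonneg_left this hC₁0.le]
    have hopt' : ∀ σ : Equiv.Perm (Fin (n + n)), σ ≠ μm k →
        ∑ p : Fin (n + n), |((σ p : Fin (n + n)) : ℤ) - (p : ℤ)| * ((((4 * q + 4 * (k : ℕ) + 3 : ℕ) : ℤ)) - 2 * |((σ p : Fin (n + n)) : ℤ) - (p : ℤ)|) <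
        ∑ p : Fin (n + n), |((μm k p : Fin (n + n)) : ℤ) - (p : ℤ)| * ((((4 * q + 4 * (k : ℕ) + 3 : ℕ) : ℤ)) - 2 * |((μm k p : Fin (n + n)) : ℤ) - (p : ℤ)|) := by
      intro σ' hσ'; have := hμopt k σ' hσ'; push_cast at this ⊢; exact this
    exact pencil_transfer (((4 * q + 4 * (k : ℕ) + 3 : ℕ) : ℤ)) (2 * C₁ * (tn k : ℤ)) (((n : ℤ) + n) * G) (θb k) C rfl hCk ht g
      (μm k) hgsum hopt' σ hσ
  -- the full chain: bottom members first, then the bipartite phases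
  let θ'' : Fin (M + (K₁ + K₂) + 1) → ℤ := fun k =>
    if h : (k : ℕ) < M then θb ⟨k, h⟩ else θp ⟨k - M, by omega⟩
  let τ'' : Fin (M + (K₁ + K₂) + 1) → Equiv.Perm (Fin (n + n)) := fun k =>
    if h : (k : ℕ) < M then μm ⟨k, h⟩ else τp ⟨k - M, by omega⟩
  have hθ''mono : StrictMono θ'' := by
    intro i j hij
    have hij' : (i : ℕ) < j := hij
    by_cases hi : (i : ℕ) < M <;> by_cases hj : (j : ℕ) < M
    · simp only [θ'', dif_pos hi, dif_pos hj]; exact hθbmono _ _ hij'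
    · simp only [θ'', dif_pos hi, dif_neg hj]
      exact lt_of_lt_of_le (hθbtop _) (hθplow _)
    · omega
    · simp only [θ'', dif_neg hi, dif_neg hj]
      exact hθpmono (show (⟨(i : ℕ) - M, by omega⟩ : Fin (K₁ + K₂ + 1)) < ⟨j - M, by omega⟩ from Fin.mk_lt_mk.mpr (by omega))
  have hopt'' : ∀ k (σ : Equiv.Perm (Fin (n + n))), σ ≠ τ'' k → W (θ'' k) σ < W (θ'' k) (τ'' k) := by
    intro k σ hσ
    by_cases h : (k : ℕ) < M
    · simp only [θ'', τ'', dif_pos h] at hσ ⊢; exact hoptb _ σ hσ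
    · simp only [θ'', τ'', dif_neg h] at hσ ⊢; exact hoptp _ σ hσ
  have hinj'' : Function.Injective τ'' := by
    intro i j hij
    by_cases hi : (i : ℕ) < M <;> by_cases hj : (j : ℕ) < M
    · simp only [τ'', dif_pos hi, dif_pos hj] at hij
      have e1 := hμA ⟨i, hi⟩; have e2 := hμA ⟨j, hj⟩
      rw [hij] at e1; rw [e1] at e2
      exact Fin.ext (by simp only at e2; omega)
    · exfalso
      simp only [τ'', dif_pos hi, dif_neg hj] at hij
      have e1 := hμB ⟨i, hi⟩; have e2 := hτp_q ⟨j - M, by omega⟩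
      rw [hij] at e1; omega
    · exfalso
      simp only [τ'', dif_neg hi, dif_pos hj] at hij
      have e1 := hμB ⟨j, hj⟩; have e2 := hτp_q ⟨i - M, by omega⟩
      rw [← hij] at e1; omega
    · simp only [τ'', dif_neg hi, dif_neg hj] at hij
      have := hinjp hij
      rw [Fin.ext_iff] at this; simp only at this
      exact Fin.ext (by omega)
  have hfinal : M + (K₁ + K₂) + 1 ≤ N₁ + N₂ + M := hB α' (M + (K₁ + K₂)) θ'' τ'' hθ''mono hinj'' hopt''
  omega

/-- **THE MORPH-DOUBLING LAW** for the quadratic-slope class: `¬ FSIB (2q) (·²) N₁ → ¬ FSIB (2q) (·²) N₂ → ¬ FSIB (2q+2q) (·²) (N₁+N₂+⌊q/2⌋)`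
(`q ≥ 2`), i.e. `Φ_Q(2n) ≥ Φ_Q(n) + Φ_Q(n)′ − 1 + ⌊n/4⌋` for even `n ≥ 4` — the hypothesis `hM` of `…ToeplitzDoublingTower` §Morph with
`⌊n/4⌋` in place of `n − 1` (odd members only). -/
theorem fixedSlope_sq_doubling_morph {q N₁ N₂ : ℕ} (hq : 2 ≤ q)
    (h₁ : ¬ FixedSlopeInstanceBound (2 * q) (fun δ : ℤ => δ ^ 2) N₁)
    (h₂ : ¬ FixedSlopeInstanceBound (2 * q) (fun δ : ℤ => δ ^ 2) N₂) :
    ¬ FixedSlopeInstanceBound (2 * q + 2 * q) (fun δ : ℤ => δ ^ 2) (N₁ + N₂ + q / 2) := by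
  rw [fixedSlopeInstanceBound_iff_free] at h₁ h₂ ⊢
  exact not_fixedSlopeFree_sq_double_morph hq h₁ h₂

end Summit.ValiantsHypothesis.ValiantsHypothesis.Theorems.KPlusLogSqLaw.Toeplitz
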